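import Summits.FinalStateConjecture.FinalStateConjecture.Theorems.ZeroEnergyKerrOrBombStationaryLimitReductionRecutCoveringJunctionCore
import Literature.Geometry.Lorentzian.BackgroundChartCalculus
import Literature.Geometry.Lorentzian.TimeCones
import Literature.Geometry.Lorentzian.ConvergenceTransport
import Literature.Geometry.Lorentzian.MinkowskiGlobalHyperbolicity
import Literature.Geometry.Lorentzian.KerrSchildCoord
import Literature.Geometry.Lorentzian.KerrTimelikeSpan
import Mathlib.Analysis.SpecialFunctions.Trigonometric.Deriv
import HarnessLib

/-!
# Route ZeroEnergyKerrOrBomb · crux `FinalStateFromKerrOrBomb` (stmt-FinalStateConjecture-17839), line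
# `SketchIdeator1` — stub `stub_recutJunctionCoreOriented`, ingredient (α) in the ERGOREGION: the helical
# Kerr–Schild lines `T + ω(r)Φ` in the certified hole tubes are future timelike down to `r₊ + δ`

Helper file (`--supports stmt-FinalStateConjecture-17839`; registered helper `recutJunction_holeTube_ergo_slab`) of
the lead's wave-3 stub worker (2026-08-17), companion of `…RecutJunctionHoleTube.lean` (p141608: the same outside the
ergoregion, flowing `∂_{t*}`), `…RecutJunctionPastBoundary.lean` (p141631) and `…RecutJunctionKerrDrsrUniform.lean`
(uniform DRSR margin = the hypothesis `hunif` below; merge to the predicate `r ≥ r₊ + δ`).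

In the ergoregion `∂_{t*}` is spacelike; we flow the HELICAL Kerr–Schild line `q(s) = (x⁰ + s, R_{ωs}(x¹, x²), x³)`,
`ω = 2Mar/(r² + a²)²` at `r = r(x)` (DRSR Lemma 4.7.1), whose velocity is the DRSR vector `V_ω = ∂₀ + ω(r)Φ` at `q(s)`
(`r`, `x³`, `(x¹)² + (x²)²` are constant along `q`, §1), timelike on the whole exterior (`Kerr.bilin_drsrVector_neg`)
with margin `m` and size `K_V` uniform on `{r₊ + δ ≤ r ≤ R_m}` (hypothesis `hunif`). §2: `dA dΘ V_ω` is `𝓑`-future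
timelike ((F5), isometry clause, timecone lemma, `g(V, V_ω) = −1`). §3: the chart curve `s ↦ P (Θ (q s))` has velocity
`Λ dΘ V_ω` of norm `≤ ‖Λ‖ L₁ K_V` (`kerrChartedWith_global_bounds`), timelike once the `C⁰` deviation on the certified
slabs is `< ε`, `ε (‖Λ‖ L₁ K_V)² < m`, future by clause (ii), and stays certified (adapted radius `≤ R_m + L₁ ≤ R T`,
chart time `≥ c (x⁰ + s) − L₁`). §4: late certified tube points with `r₊ + δ ≤ r ≤ R_m`, `x⁰ ≤ τ₁`, `r ≤ R'ᵢ τ₁` lie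
in `J⁻(recutCertifiedSlab … R' τ₁)`. Elementary; nothing restated. References: Dafermos–Rodnianski–Shlapentokh-Rothman
arXiv:1402.7034, Lemma 4.7.1; Dafermos–Luk arXiv:1710.01722, Conjecture 1 (b)–(c); O'Neill 1983, Ch. 5, Lemma 5.29,
Ch. 14, pp. 402–403.
-/

set_option linter.dupNamespace false

noncomputable section

open scoped Manifold ContDiff Topology ENNReal
open Set Filter Function Literature.Geometry.Lorentzian

namespace Summit.FinalStateConjecture.FinalStateConjecture.Theorems.SymplecticDualOfTheBomb

open Summit.FinalStateConjecture.FinalStateConjecture.Theorems.OneLockedExplosion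

/-! ## §1 The helical Kerr–Schild line `q(s) = (x⁰ + s, R_{ωs}(x¹, x²), x³)` -/

section Helix

variable {Om : ℝ} {x : E4} {q : ℝ → E4}

/-- Components of the helix `q s = x + s e₀ + (x¹ (cos ωs − 1) − x² sin ωs) e₁ + (x¹ sin ωs + x² (cos ωs − 1)) e₂`
(hypothesis form, no definition introduced). [folklore] -/
private theorem helix_apply (hq : ∀ s : ℝ, q s = x + s • E4.basisVector 0 +
      (x 1 * (Real.cos (Om * s) - 1) - x 2 * Real.sin (Om * s)) • E4.basisVector 1 +
      (x 1 * Real.sin (Om * s) + x 2 * (Real.cos (Om * s) - 1)) • E4.basisVector 2) (s : ℝ) :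
    q s 0 = x 0 + s ∧ q s 1 = x 1 * Real.cos (Om * s) - x 2 * Real.sin (Om * s) ∧
      q s 2 = x 1 * Real.sin (Om * s) + x 2 * Real.cos (Om * s) ∧ q s 3 = x 3 := by
  refine ⟨?_, ?_, ?_, ?_⟩ <;> simp [hq, E4.basisVector] <;> ring

/-- Along the helix `(x¹)² + (x²)²`, `x³`, the spatial norm, the Kerr–Schild radius and `H` are constant. [folklore] -/
private theorem helix_invariants (hq : ∀ s : ℝ, q s = x + s • E4.basisVector 0 +
      (x 1 * (Real.cos (Om * s) - 1) - x 2 * Real.sin (Om * s)) • E4.basisVector 1 +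
      (x 1 * Real.sin (Om * s) + x 2 * (Real.cos (Om * s) - 1)) • E4.basisVector 2) (M a : ℝ) (s : ℝ) :
    q s 1 ^ 2 + q s 2 ^ 2 = x 1 ^ 2 + x 2 ^ 2 ∧ Kerr.radius a (q s) = Kerr.radius a x ∧
      Kerr.scalarH M a (q s) = Kerr.scalarH M a x := by
  obtain ⟨-, h1, h2, h3⟩ := helix_apply hq s
  have h12 : q s 1 ^ 2 + q s 2 ^ 2 = x 1 ^ 2 + x 2 ^ 2 := by
    rw [h1, h2]; nlinarith [Real.cos_sq_add_sin_sq (Om * s)]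
  have hsn : E4.spatialNorm (q s) = E4.spatialNorm x := by
    have h : E4.spatialNorm (q s) ^ 2 = E4.spatialNorm x ^ 2 := by
      rw [E4.spatialNorm_sq, E4.spatialNorm_sq, h3]; linarith
    exact (sq_eq_sq₀ (E4.spatialNorm_nonneg _) (E4.spatialNorm_nonneg _)).1 h
  have hrad : Kerr.radius a (q s) = Kerr.radius a x := by simp only [Kerr.radius, hsn, h3]
  exact ⟨h12, hrad, by simp only [Kerr.scalarH, hrad, h3]⟩

/-- **The velocity of the helix is the DRSR vector at the running point**: with `ω = ω(r(x))`,
`q' s = e₀ + ω Φ(q s) = V_ω(q s)` (`Φ = x¹∂₂ − x²∂₁`, the radius is constant along `q`). [folklore] -/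
private theorem helix_hasDerivAt (hq : ∀ s : ℝ, q s = x + s • E4.basisVector 0 +
      (x 1 * (Real.cos (Om * s) - 1) - x 2 * Real.sin (Om * s)) • E4.basisVector 1 +
      (x 1 * Real.sin (Om * s) + x 2 * (Real.cos (Om * s) - 1)) • E4.basisVector 2) {M a : ℝ}
    (hOm : Om = Kerr.drsrAngularVelocity M a (Kerr.radius a x)) (s : ℝ) :
    HasDerivAt q (Kerr.drsrVector M a (q s)) s := by
  obtain ⟨-, h1, h2, -⟩ := helix_apply hq s
  have hc : HasDerivAt (fun t : ℝ ↦ Real.cos (Om * t)) (-Real.sin (Om * s) * Om) s := by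
    simpa using ((hasDerivAt_id s).const_mul Om).cos
  have hs : HasDerivAt (fun t : ℝ ↦ Real.sin (Om * t)) (Real.cos (Om * s) * Om) s := by
    simpa using ((hasDerivAt_id s).const_mul Om).sin
  have hf₁ : HasDerivAt (fun t : ℝ ↦ x 1 * (Real.cos (Om * t) - 1) - x 2 * Real.sin (Om * t))
      (x 1 * (-Real.sin (Om * s) * Om) - x 2 * (Real.cos (Om * s) * Om)) s :=
    ((hc.sub_const 1).const_mul (x 1)).sub (hs.const_mul (x 2))
  have hf₂ : HasDerivAt (fun t : ℝ ↦ x 1 * Real.sin (Om * t) + x 2 * (Real.cos (Om * t) - 1))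
      (x 1 * (Real.cos (Om * s) * Om) + x 2 * (-Real.sin (Om * s) * Om)) s :=
    (hs.const_mul (x 1)).add ((hc.sub_const 1).const_mul (x 2))
  have hline : HasDerivAt (fun t : ℝ ↦ x + t • E4.basisVector 0) (E4.basisVector 0) s := by
    simpa using ((hasDerivAt_id s).smul_const (E4.basisVector 0)).const_add x
  have hsum := (hline.add (hf₁.smul_const (E4.basisVector 1))).add (hf₂.smul_const (E4.basisVector 2))
  have hsum' : HasDerivAt q (E4.basisVector 0 +
      (x 1 * (-Real.sin (Om * s) * Om) - x 2 * (Real.cos (Om * s) * Om)) • E4.basisVector 1 +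
      (x 1 * (Real.cos (Om * s) * Om) + x 2 * (-Real.sin (Om * s) * Om)) • E4.basisVector 2) s := by
    rw [show q = _ from funext hq]; exact hsum
  refine hsum'.congr_deriv ?_
  have hOmq : Kerr.drsrAngularVelocity M a (Kerr.radius a (q s)) = Om := by
    rw [(helix_invariants hq M a s).2.1, hOm]
  rw [Kerr.drsrVector, hOmq, Kerr.axialVector, h1, h2]
  ext i
  fin_cases i <;> simp [E4.basisVector] <;> ring

end Helix

/-! ## §2 The hole side: `dA dΘ V_ω` is future timelike -/

section Hole

variable {𝓑 : StationaryAFBlackHole.{0}} (A : 𝓑.AdaptedChart) {M a c r₀ : ℝ} {Θ : E4 → E4}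

/-- **The adapted image of the DRSR vector is future timelike on the whole exterior** (under `IsKerrChartedWith` and
(F5)): `g_𝓑(dA dΘ V_ω, ·)` is `g_{M,a}(V_ω, V_ω) < 0` (DRSR Lemma 4.7.1), and `g_{M,a}(V, V_ω) = −V_ω⁰ = −1` with the
future timelike `dA dΘ V` (timecone lemma). [folklore] -/
private theorem adapted_drsr_future (hW : IsKerrChartedWith 𝓑 A M a c r₀ Θ)
    (hF5 : ∀ u ∈ (Kerr.exterior M a : Set E4), ∀ h : Θ u ∈ A.domain,
      𝓑.timeOrientation.IsFutureDirected
        (mfderiv 𝓘(ℝ, E4) (𝓡 4) A.toFun ⟨Θ u, h⟩ (fderiv ℝ Θ u (Kerr.timeVector M a u))))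
    {x : E4} (hx : x ∈ (Kerr.exterior M a : Set E4)) (h : Θ x ∈ A.domain) :
    𝓑.metric.IsTimelike (mfderiv 𝓘(ℝ, E4) (𝓡 4) A.toFun ⟨Θ x, h⟩ (fderiv ℝ Θ x (Kerr.drsrVector M a x))) ∧
      𝓑.timeOrientation.IsFutureDirected
        (mfderiv 𝓘(ℝ, E4) (𝓡 4) A.toFun ⟨Θ x, h⟩ (fderiv ℝ Θ x (Kerr.drsrVector M a x))) := by
  obtain ⟨hsub, -, -, -, -, -, -, -, hiso, -, -⟩ := hW
  have hrad : 0 < Kerr.radius a x := Kerr.radius_pos_of_mem_region hx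
  have hrp : Kerr.rPlus M a < Kerr.radius a x := (le_max_left _ _).trans_lt (Kerr.mem_exterior.1 hx)
  have hpb : ∀ v w : E4, 𝓑.metric.val (A.toFun ⟨Θ x, h⟩)
      (mfderiv 𝓘(ℝ, E4) (𝓡 4) A.toFun ⟨Θ x, h⟩ (fderiv ℝ Θ x v))
      (mfderiv 𝓘(ℝ, E4) (𝓡 4) A.toFun ⟨Θ x, h⟩ (fderiv ℝ Θ x w)) = Kerr.bilin M a x v w := by
    intro v w
    rw [← hiso x hx v w, A.bilin_eq ⟨Θ x, h⟩]
    rfl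
  have hXX : 𝓑.metric.IsTimelike (mfderiv 𝓘(ℝ, E4) (𝓡 4) A.toFun ⟨Θ x, h⟩ (fderiv ℝ Θ x (Kerr.timeVector M a x))) := by
    show 𝓑.metric.val _ _ _ < 0
    rw [hpb, Kerr.bilin_timeVector_timeVector hrad]
    linarith [Kerr.scalarH_nonneg hsub.pos.le a x]
  have hYY : 𝓑.metric.IsTimelike (mfderiv 𝓘(ℝ, E4) (𝓡 4) A.toFun ⟨Θ x, h⟩ (fderiv ℝ Θ x (Kerr.drsrVector M a x))) := by
    show 𝓑.metric.val _ _ _ < 0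
    rw [hpb]
    exact Kerr.bilin_drsrVector_neg hsub hrp
  have hXY : 𝓑.metric.val (A.toFun ⟨Θ x, h⟩)
      (mfderiv 𝓘(ℝ, E4) (𝓡 4) A.toFun ⟨Θ x, h⟩ (fderiv ℝ Θ x (Kerr.timeVector M a x)))
      (mfderiv 𝓘(ℝ, E4) (𝓡 4) A.toFun ⟨Θ x, h⟩ (fderiv ℝ Θ x (Kerr.drsrVector M a x))) < 0 := by
    rw [hpb, Kerr.bilin_timeVector hrad, Kerr.drsrVector_apply_zero]
    norm_num
  exact ⟨hYY, 𝓑.timeOrientation.isFutureDirected_of_val_lt_zero (hF5 x hx h) hXX hYY.isCausal hXY⟩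

end Hole

/-! ## §3 The moved chart: the helical line in the certified tube is a future timelike curve -/

section Curve

variable (𝓢 : Spacetime.{0} 4) (B : ModelBackground)

/-- Private copy of `norm_deviation_lt_of_truncDeviationCk_lt` (`…JunctionTimeFunction.lean`, unbuilt today). [folklore] -/
private theorem norm_deviation_lt_of_truncDeviationCk_lt_w3e (ψ : B.domain → 𝓢.carrier) {k : ℕ} {R τ ε : ℝ}
    (hε : 0 < ε) (h : 𝓢.truncDeviationCk B ψ k R τ < ENNReal.ofReal ε) {x : B.domain}
    (hx : x ∈ B.truncTimeSlab R τ) : ‖𝓢.deviation B ψ x‖ < ε := by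
  have h2 := enorm_iteratedFDeriv_le_supCkENorm (Nat.zero_le k) (mem_image_of_mem Subtype.val hx)
    (𝓢.deviationExtend B ψ)
  rw [← ofReal_norm, norm_iteratedFDeriv_zero, 𝓢.deviationExtend_coe] at h2
  exact (ENNReal.ofReal_lt_ofReal_iff hε).1 (h2.trans_lt h)

/-- Private copy of `isTimelike_mfderiv_of_norm_deviation_le` (`…JunctionTimeFunction.lean`, unbuilt today). [folklore] -/
private theorem isTimelike_mfderiv_of_norm_deviation_le_w3e (ψ : B.domain → 𝓢.carrier) {x : B.domain} {V : E4}
    {ε : ℝ} (hdev : ‖𝓢.deviation B ψ x‖ ≤ ε) (hV : B.bilin x.1 V V + ε * ‖V‖ ^ 2 < 0) :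
    𝓢.metric.IsTimelike (mfderiv 𝓘(ℝ, E4) (𝓡 4) ψ x V) := by
  have h1 : |𝓢.deviation B ψ x V V| ≤ ‖𝓢.deviation B ψ x‖ * ‖V‖ * ‖V‖ := by
    rw [← Real.norm_eq_abs]; exact (𝓢.deviation B ψ x).le_opNorm₂ V V
  have h2 : ‖𝓢.deviation B ψ x‖ * ‖V‖ * ‖V‖ ≤ ε * ‖V‖ ^ 2 := by
    rw [pow_two, ← mul_assoc]
    exact mul_le_mul_of_nonneg_right (mul_le_mul_of_nonneg_right hdev (norm_nonneg V)) (norm_nonneg V)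
  have h3 := (abs_le.1 (h1.trans h2)).2
  rw [Spacetime.deviation_apply] at h3
  show 𝓢.metric.val (ψ x) _ _ < 0
  linarith

variable {𝓑 : StationaryAFBlackHole.{0}} (A : 𝓑.AdaptedChart) (Λ : lorentzGroup) (c₀ : E4) {M a c r₀ : ℝ} {Θ : E4 → E4}

/-- **The chart image of the helical Kerr–Schild line is a future timelike curve (one hole, general late chart)**:
under the data listed in the module docstring (§3), for `x` in the exterior with `r₊ + δ ≤ r(x) ≤ R_m`,
`c x⁰ − L₁ ≥ T`, `> τ₀`, and `S > 0`, the chart point of `x` is chronologically before that of `q(S)`. [folklore] -/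
private theorem helixLine_mem_chronologicalFuture (hW : IsKerrChartedWith 𝓑 A M a c r₀ Θ)
    (hF5 : ∀ u ∈ (Kerr.exterior M a : Set E4), ∀ h : Θ u ∈ A.domain,
      𝓑.timeOrientation.IsFutureDirected
        (mfderiv 𝓘(ℝ, E4) (𝓡 4) A.toFun ⟨Θ u, h⟩ (fderiv ℝ Θ u (Kerr.timeVector M a u))))
    (ψ : (A.background.boost Λ c₀).domain → 𝓢.carrier) (hψ : ContMDiff 𝓘(ℝ, E4) (𝓡 4) ∞ ψ) {τ₀ : ℝ}
    (hii : ∀ (y : (A.background.boost Λ c₀).domain) (w : E4), τ₀ < (A.background.boost Λ c₀).time y.1 →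
      𝓑.timeOrientation.IsFutureDirected (mfderiv 𝓘(ℝ, E4) (𝓡 4) A.toFun
        ⟨poincareInv Λ c₀ y.1, ModelBackground.mem_boost_domain.1 y.2⟩ ((Λ : E4 ≃L[ℝ] E4).symm w)) →
      𝓢.metric.IsTimelike (mfderiv 𝓘(ℝ, E4) (𝓡 4) ψ y w) →
        𝓢.timeOrientation.IsFutureDirected (mfderiv 𝓘(ℝ, E4) (𝓡 4) ψ y w))
    {k : ℕ} {R : ℝ → ℝ} (hRm : Monotone R) {ε T L₁ m KV Rm δ : ℝ} (hε : 0 < ε) (hL₁ : 0 ≤ L₁)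
    (htilt : ∀ u ∈ (Kerr.exterior M a : Set E4), |Θ u 0 - c * u 0| ≤ L₁)
    (hradial : ∀ u ∈ (Kerr.exterior M a : Set E4), A.radius (Θ u) ≤ Kerr.radius a u + L₁)
    (hderiv : ∀ u ∈ (Kerr.exterior M a : Set E4), ∀ v : E4, ‖fderiv ℝ Θ u v‖ ≤ L₁ * ‖v‖)
    (hmKV : ∀ u : E4, Kerr.rPlus M a + δ ≤ Kerr.radius a u → Kerr.radius a u ≤ Rm →
      Kerr.bilin M a u (Kerr.drsrVector M a u) (Kerr.drsrVector M a u) ≤ -m ∧ ‖Kerr.drsrVector M a u‖ ≤ KV)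
    (hεm : ε * (‖((Λ : E4 ≃L[ℝ] E4) : E4 →L[ℝ] E4)‖ * L₁ * KV) ^ 2 < m)
    (hdev : ∀ τ, T ≤ τ → 𝓢.truncDeviationCk (A.background.boost Λ c₀) ψ k (R τ) τ < ENNReal.ofReal ε)
    (hRT : Rm + L₁ ≤ R T)
    {x : E4} (hx : x ∈ (Kerr.exterior M a : Set E4)) (hδx : Kerr.rPlus M a + δ ≤ Kerr.radius a x)
    (hxR : Kerr.radius a x ≤ Rm) (hT : T ≤ c * x 0 - L₁) (hτ₀ : τ₀ < c * x 0 - L₁)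
    {q : ℝ → E4} (hq : ∀ s : ℝ, q s = x + s • E4.basisVector 0 +
      (x 1 * (Real.cos (Kerr.drsrAngularVelocity M a (Kerr.radius a x) * s) - 1) -
        x 2 * Real.sin (Kerr.drsrAngularVelocity M a (Kerr.radius a x) * s)) • E4.basisVector 1 +
      (x 1 * Real.sin (Kerr.drsrAngularVelocity M a (Kerr.radius a x) * s) +
        x 2 * (Real.cos (Kerr.drsrAngularVelocity M a (Kerr.radius a x) * s) - 1)) • E4.basisVector 2)
    {S : ℝ} (hS : 0 < S)
    (h₀ : (Λ : E4 ≃L[ℝ] E4) (Θ x) + c₀ ∈ (A.background.boost Λ c₀).domain)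
    (h₁ : (Λ : E4 ≃L[ℝ] E4) (Θ (q S)) + c₀ ∈ (A.background.boost Λ c₀).domain) :
    ψ ⟨(Λ : E4 ≃L[ℝ] E4) (Θ (q S)) + c₀, h₁⟩ ∈
      𝓢.metric.chronologicalFuture 𝓢.timeOrientation {ψ ⟨(Λ : E4 ≃L[ℝ] E4) (Θ x) + c₀, h₀⟩} := by
  obtain ⟨hsub, hc, -, hr₀, hΘs, -, hΘm, -, hiso, -, -⟩ := id hW
  have hsubreg : (Kerr.exterior M a : Set E4) ⊆ (Kerr.region a r₀ : Set E4) := fun y hy ↦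
    Kerr.mem_region.2 ((max_le_max hr₀.le le_rfl).trans_lt (Kerr.mem_exterior.1 hy))
  have hΛ : ∀ u : E4, ‖(Λ : E4 ≃L[ℝ] E4) u‖ ≤ ‖((Λ : E4 ≃L[ℝ] E4) : E4 →L[ℝ] E4)‖ * ‖u‖ := fun u ↦
    ((Λ : E4 ≃L[ℝ] E4) : E4 →L[ℝ] E4).le_opNorm u
  -- the running Kerr–Schild point `q s`
  have hinv := fun s ↦ helix_invariants hq M a s
  have hqt : ∀ s : ℝ, q s 0 = x 0 + s := fun s ↦ (helix_apply hq s).1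
  have hqx : ∀ s : ℝ, q s ∈ (Kerr.exterior M a : Set E4) := fun s ↦
    Kerr.mem_exterior.2 (by rw [(hinv s).2.1]; exact Kerr.mem_exterior.1 hx)
  have hq0 : q 0 = x := by rw [hq]; simp
  have hΘd : ∀ s : ℝ, DifferentiableAt ℝ Θ (q s) := fun s ↦
    (hΘs.differentiableOn (by simp)).differentiableAt ((Kerr.region a r₀).isOpen.mem_nhds (hsubreg (hqx s)))
  -- the chart curve `Q s = P (Θ (q s))` and its velocity `w s = Λ dΘ_{q s} V_ω(q s)`
  obtain ⟨Q, hQ⟩ : ∃ Q : ℝ → E4, ∀ s, Q s = (Λ : E4 ≃L[ℝ] E4) (Θ (q s)) + c₀ := ⟨_, fun _ ↦ rfl⟩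
  obtain ⟨w, hw⟩ : ∃ w : ℝ → E4, ∀ s, w s = (Λ : E4 ≃L[ℝ] E4) (fderiv ℝ Θ (q s) (Kerr.drsrVector M a (q s))) :=
    ⟨_, fun _ ↦ rfl⟩
  have hPQ : ∀ s : ℝ, poincareInv Λ c₀ (Q s) = Θ (q s) := fun s ↦ by rw [hQ, poincareInv_apply_add]
  have hmem : ∀ s : ℝ, Q s ∈ ((A.background.boost Λ c₀).domain : Set E4) := fun s ↦ by
    show poincareInv Λ c₀ (Q s) ∈ (A.domain : Set E4)
    rw [hPQ]; exact hΘm (hsubreg (hqx s))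
  have htime : ∀ s : ℝ, (A.background.boost Λ c₀).time (Q s) = Θ (q s) 0 := fun s ↦ by
    show (poincareInv Λ c₀ (Q s)) 0 = _; rw [hPQ]
  have hradius : ∀ s : ℝ, (A.background.boost Λ c₀).radius (Q s) = A.radius (Θ (q s)) := fun s ↦ by
    show A.radius (poincareInv Λ c₀ (Q s)) = _; rw [hPQ]
  have htime_ge : ∀ s : ℝ, 0 ≤ s → c * x 0 - L₁ ≤ (A.background.boost Λ c₀).time (Q s) := fun s hs ↦ by
    have h := (abs_le.1 (htilt _ (hqx s))).1
    rw [hqt] at h; rw [htime]; nlinarith [hc]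
  have hsymm : ∀ s : ℝ, (Λ : E4 ≃L[ℝ] E4).symm (w s) = fderiv ℝ Θ (q s) (Kerr.drsrVector M a (q s)) := fun s ↦ by
    rw [hw, ContinuousLinearEquiv.symm_apply_apply]
  have hQderiv : ∀ s : ℝ, HasDerivAt Q (w s) s := fun s ↦ by
    have h1 : HasDerivAt (Θ ∘ q) (fderiv ℝ Θ (q s) (Kerr.drsrVector M a (q s))) s :=
      (hΘd s).hasFDerivAt.comp_hasDerivAt s (helix_hasDerivAt hq rfl s)
    have h2 := (((Λ : E4 ≃L[ℝ] E4) : E4 →L[ℝ] E4).hasFDerivAt.comp_hasDerivAt s h1).add_const c₀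
    rw [show Q = fun s ↦ (Λ : E4 ≃L[ℝ] E4) (Θ (q s)) + c₀ from funext hQ, hw]; exact h2
  -- background length and Euclidean size of the velocity
  have hbilin : ∀ s : ℝ, (A.background.boost Λ c₀).bilin (Q s) (w s) (w s) =
      Kerr.bilin M a (q s) (Kerr.drsrVector M a (q s)) (Kerr.drsrVector M a (q s)) := fun s ↦ by
    rw [ModelBackground.boost_bilin_apply, StationaryAFBlackHole.AdaptedChart.background_bilin, hsymm, hPQ,
      hiso _ (hqx s)]
  have hm' : ∀ s : ℝ, Kerr.bilin M a (q s) (Kerr.drsrVector M a (q s)) (Kerr.drsrVector M a (q s)) ≤ -m ∧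
      ‖Kerr.drsrVector M a (q s)‖ ≤ KV := fun s ↦
    hmKV (q s) (by rw [(hinv s).2.1]; exact hδx) (by rw [(hinv s).2.1]; exact hxR)
  have hwn : ∀ s : ℝ, ‖w s‖ ≤ ‖((Λ : E4 ≃L[ℝ] E4) : E4 →L[ℝ] E4)‖ * L₁ * KV := fun s ↦ by
    rw [hw, mul_assoc]
    exact (hΛ _).trans (mul_le_mul_of_nonneg_left
      ((hderiv _ (hqx s) _).trans (mul_le_mul_of_nonneg_left (hm' s).2 hL₁)) (norm_nonneg _))
  -- pointwise along the curve: pinching, timelikeness, futureness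
  have hdev' : ∀ s : ℝ, 0 ≤ s → ‖𝓢.deviation (A.background.boost Λ c₀) ψ ⟨Q s, hmem s⟩‖ < ε := fun s hs ↦ by
    refine norm_deviation_lt_of_truncDeviationCk_lt_w3e 𝓢 (A.background.boost Λ c₀) ψ hε
      (hdev ((A.background.boost Λ c₀).time (Q s)) (hT.trans (htime_ge s hs))) ⟨rfl, ?_⟩
    rw [hradius]
    refine ((hradial _ (hqx s)).trans ?_).trans ((hRT.trans (hRm (hT.trans (htime_ge s hs)))))
    rw [(hinv s).2.1]; linarith
  have htl : ∀ s : ℝ, 0 ≤ s → 𝓢.metric.IsTimelike (mfderiv 𝓘(ℝ, E4) (𝓡 4) ψ ⟨Q s, hmem s⟩ (w s)) := fun s hs ↦ by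
    refine isTimelike_mfderiv_of_norm_deviation_le_w3e 𝓢 (A.background.boost Λ c₀) ψ (hdev' s hs).le ?_
    rw [hbilin]
    have h1 : ‖w s‖ ^ 2 ≤ (‖((Λ : E4 ≃L[ℝ] E4) : E4 →L[ℝ] E4)‖ * L₁ * KV) ^ 2 :=
      pow_le_pow_left₀ (norm_nonneg _) (hwn s) 2
    nlinarith [(hm' s).1, mul_le_mul_of_nonneg_left h1 hε.le]
  have hfut : ∀ s : ℝ, 0 ≤ s →
      𝓢.timeOrientation.IsFutureDirected (mfderiv 𝓘(ℝ, E4) (𝓡 4) ψ ⟨Q s, hmem s⟩ (w s)) := fun s hs ↦ by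
    refine hii ⟨Q s, hmem s⟩ (w s) (hτ₀.trans_le (htime_ge s hs)) ?_ (htl s hs)
    have key : ∀ (p : E4) (hp : p ∈ A.domain), p = Θ (q s) →
        𝓑.timeOrientation.IsFutureDirected (mfderiv 𝓘(ℝ, E4) (𝓡 4) A.toFun ⟨p, hp⟩
          (fderiv ℝ Θ (q s) (Kerr.drsrVector M a (q s)))) := by
      rintro p hp rfl
      exact (adapted_drsr_future A hW hF5 (hqx s) hp).2
    rw [hsymm]; exact key _ _ (hPQ s)
  -- the curve `Φ ∘ Q` through the parametrisation `Φ = ψ ∘ (chartAt E4 y₀).symm`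
  set y₀ : (A.background.boost Λ c₀).domain := ⟨Q 0, hmem 0⟩ with hy₀
  set Φ : E4 → 𝓢.carrier := ψ ∘ (chartAt E4 y₀).symm with hΦ
  have hΦq : ∀ (p : E4) (hp : p ∈ ((A.background.boost Λ c₀).domain : Set E4)), Φ p = ψ ⟨p, hp⟩ := fun p hp ↦
    congrFun (Spacetime.comp_chartAt_symm_comp_subtypeVal ψ y₀) ⟨p, hp⟩
  have hmd : ∀ s : ℝ, MDifferentiableAt 𝓘(ℝ, E4) (𝓡 4) ψ ⟨Q s, hmem s⟩ := fun s ↦ hψ.mdifferentiableAt (by simp)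
  have hΦd : ∀ s : ℝ, MDifferentiableAt 𝓘(ℝ, E4) (𝓡 4) Φ (Q s) := fun s ↦
    ((𝓢.contMDiffOn_comp_chartAt_symm (A.background.boost Λ c₀) ψ y₀ hψ _ (hmem s)).contMDiffAt
      ((A.background.boost Λ c₀).domain.isOpen.mem_nhds (hmem s))).mdifferentiableAt (by simp)
  have hγ : 𝓢.metric.IsFutureTimelikeCurveOn 𝓢.timeOrientation (Φ ∘ Q) (Icc 0 S) := by
    intro t ht
    have hQm : HasMFDerivAt 𝓘(ℝ, ℝ) 𝓘(ℝ, E4) Q t (ContinuousLinearMap.smulRight (1 : ℝ →L[ℝ] ℝ) (w t)) :=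
      hasMFDerivAt_iff_hasFDerivAt.2 (hQderiv t).hasFDerivAt
    have hcomp := (hΦd t).hasMFDerivAt.comp t hQm
    have hvel : velocity (𝓡 4) (Φ ∘ Q) t = mfderiv 𝓘(ℝ, E4) (𝓡 4) ψ ⟨Q t, hmem t⟩ (w t) := by
      show mfderiv 𝓘(ℝ, ℝ) (𝓡 4) (Φ ∘ Q) t 1 = _
      rw [hcomp.mfderiv]
      show mfderiv 𝓘(ℝ, E4) (𝓡 4) Φ (Q t) ((1 : ℝ) • w t) = _
      rw [one_smul, hΦ, 𝓢.mfderiv_comp_chartAt_symm_apply (A.background.boost Λ c₀) ψ y₀ (hmem t) (hmd t)]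
    have hpt : (Φ ∘ Q) t = ψ ⟨Q t, hmem t⟩ := hΦq _ (hmem t)
    refine ⟨hcomp.mdifferentiableAt, ?_, ?_⟩
    · rw [hvel, hpt]; exact htl t ht.1
    · rw [hvel, hpt]; exact hfut t ht.1
  have hI : (Φ ∘ Q) S ∈ 𝓢.metric.chronologicalFuture 𝓢.timeOrientation {(Φ ∘ Q) 0} :=
    ⟨(Φ ∘ Q) 0, mem_singleton _, Φ ∘ Q, 0, S, hS, hγ, rfl, rfl⟩
  have eS : (Φ ∘ Q) S = ψ ⟨(Λ : E4 ≃L[ℝ] E4) (Θ (q S)) + c₀, h₁⟩ := by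
    rw [Function.comp_apply, hΦq _ (hmem S)]; congr 1; exact Subtype.ext (hQ S)
  have e0 : (Φ ∘ Q) 0 = ψ ⟨(Λ : E4 ≃L[ℝ] E4) (Θ x) + c₀, h₀⟩ := by
    rw [Function.comp_apply, hΦq _ (hmem 0)]; congr 1; exact Subtype.ext ((hQ 0).trans (by rw [hq0]))
  rw [eS, e0] at hI
  exact hI

end Curve

/-! ## §4 The decomposition: certified tube points of the ergoregion flow into the recut certified slab -/

/-- **Registered helper `recutJunction_holeTube_ergo_slab` (stub `stub_recutJunctionCoreOriented`, ingredient (α) in the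
ergoregion).** Under clause (i) with monotone `Rᵢ → ∞`, `IsKerrChartedWith`, (F5), clause (ii) and the uniform DRSR
margin `hunif` (`kerr_drsrVector_uniform`): for every hole `i`, `δ > 0`, `R_m` there is `T` such that every exterior
point `x` with `r₊ + δ ≤ r(x) ≤ R_m`, chart time `(Θᵢ x)⁰ ≥ T`, `x⁰ ≤ τ₁`, `r(x) ≤ R'ᵢ τ₁` has its chart point in
`J⁻(recutCertifiedSlab d M a Θ R' τ₁)`, for every `R'` (helical flow for the time `τ₁ − x⁰`). [folklore] -/
theorem recutJunction_holeTube_ergo_slab : ∀ {𝓢 : Spacetime.{0} 4} {O : Set 𝓢.carrier} {k : ℕ} (d : StationaryFinalStateDecomposition 𝓢 O k) (M a c r₀ : Fin d.N → ℝ) (Θ : Fin d.N → E4 → E4) (R : Fin d.N → ℝ → ℝ), (∀ i, Filter.Tendsto (fun τ ↦ 𝓢.truncDeviationCk (d.background i) (d.toOver.chart i) k (R i τ) τ) Filter.atTop (nhds 0)) → (∀ i, Monotone (R i)) → (∀ i, Filter.Tendsto (R i) Filter.atTop Filter.atTop) → (∀ i, IsKerrChartedWith (d.hole i) (d.adapted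 i) (M i) (a i) (c i) (r₀ i) (Θ i)) → (∀ i, ∀ u ∈ (Kerr.exterior (M i) (a i) : Set E4), ∀ h : Θ i u ∈ (d.adapted i).domain, (d.hole i).timeOrientation.IsFutureDirected (mfderiv 𝓘(ℝ, E4) (𝓡 4) (d.adapted i).toFun ⟨Θ i u, h⟩ (fderiv ℝ (Θ i) u (Kerr.timeVector (M i) (a i) u)))) → (∀ (i : Fin d.N) (y : (d.background i).domain) (w : E4), d.toOver.τ₀ < (d.background i).time y.1 → (d.hole i).timeOrientation.IsFutureDirected (mfderiv 𝓘(ℝ, E4) (𝓡 4) (d.adapted i).toFun ⟨poincareInv (d.motion i).1 (d.motion i).2 y.1, ModelBackground.mem_boost_domain.1 y.2⟩ (((d.motion i).1 : E4 ≃L[ℝ] E4).symm w)) → 𝓢.metric.IsTimelike (mfderiv 𝓘(ℝ, E4) (𝓡 4) (d.toOver.chart i) y w) → 𝓢.timeOrientation.IsFutureDirected (mfderiv 𝓘(ℝ, E4) (𝓡 4) (d.toOver.chart i) y w)) → (∀ (i : Fin d.N) (δ Rm : ℝ), 0 < δ → ∃ m KV : ℝ, 0 < m ∧ 0 ≤ KV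 ∧ ∀ x : E4, Kerr.rPlus (M i) (a i) + δ ≤ Kerr.radius (a i) x → Kerr.radius (a i) x ≤ Rm → Kerr.bilin (M i) (a i) x (Kerr.drsrVector (M i) (a i) x) (Kerr.drsrVector (M i) (a i) x) ≤ -m ∧ ‖Kerr.drsrVector (M i) (a i) x‖ ≤ KV) → ∀ (i : Fin d.N) (δ Rm : ℝ), 0 < δ → ∃ T : ℝ, ∀ (R' : Fin d.N → ℝ → ℝ) (τ₁ : ℝ), ∀ x ∈ (Kerr.exterior (M i) (a i) : Set E4), Kerr.rPlus (M i) (a i) + δ ≤ Kerr.radius (a i) x → Kerr.radius (a i) x ≤ Rm → T ≤ Θ i x 0 → x 0 ≤ τ₁ → Kerr.radius (a i) x ≤ R' i τ₁ → ∀ h₀ : ((d.motion i).1 : E4 ≃L[ℝ] E4) (Θ i x) + (d.motion i).2 ∈ (d.background i).domain, d.toOver.chart i ⟨((d.motion i).1 : E4 ≃L[ℝ] E4) (Θ i x) + (d.motion i).2, h₀⟩ ∈ 𝓢.metric.causalPast 𝓢.timeOrientation (recutCertifiedSlab d M a Θ R' τ₁) := by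
  intro 𝓢 O k d M a c r₀ Θ R hRi hRm hRt hW hF5 hii hunif i δ Rm hδ
  obtain ⟨L₁, hL₁0, hL₁⟩ := kerrChartedWith_global_bounds (hW i)
  obtain ⟨m, KV, hm, -, hmKV⟩ := hunif i δ Rm hδ
  obtain ⟨-, hc, -, hr₀, -, -, hΘm, -, -, -, -⟩ := hW i
  have hsubreg : (Kerr.exterior (M i) (a i) : Set E4) ⊆ (Kerr.region (a i) (r₀ i) : Set E4) := fun y hy ↦
    Kerr.mem_region.2 ((max_le_max hr₀.le le_rfl).trans_lt (Kerr.mem_exterior.1 hy))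
  -- the pinching level and the thresholds
  set KΛ : ℝ := ‖(((d.motion i).1 : E4 ≃L[ℝ] E4) : E4 →L[ℝ] E4)‖ with hKΛ
  obtain ⟨ε, hε, hεm⟩ : ∃ ε : ℝ, 0 < ε ∧ ε * (KΛ * L₁ * KV) ^ 2 < m := ⟨m / (2 * ((KΛ * L₁ * KV) ^ 2 + 1)),
    by positivity, by rw [div_mul_eq_mul_div, div_lt_iff₀ (by positivity)]; nlinarith [sq_nonneg (KΛ * L₁ * KV)]⟩
  obtain ⟨T₁, hT₁⟩ := Filter.eventually_atTop.1 ((hRi i).eventually (gt_mem_nhds (ENNReal.ofReal_pos.2 hε)))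
  obtain ⟨T₂, hT₂⟩ := Filter.eventually_atTop.1 ((hRt i).eventually_ge_atTop (Rm + L₁))
  set T : ℝ := max (max T₁ T₂) (d.toOver.τ₀ + 1) with hT_def
  have hderiv : ∀ u ∈ (Kerr.exterior (M i) (a i) : Set E4), ∀ v : E4, ‖fderiv ℝ (Θ i) u v‖ ≤ L₁ * ‖v‖ := fun u hu v ↦ by
    have h1 := (hL₁ u hu).2.2 1 le_rfl (by norm_num)
    rw [← norm_iteratedFDeriv_fderiv, norm_iteratedFDeriv_zero] at h1
    exact ((fderiv ℝ (Θ i) u).le_opNorm v).trans (mul_le_mul_of_nonneg_right h1 (norm_nonneg v))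
  refine ⟨T + 2 * L₁, fun R' τ₁ x hx hδx hxR hTx hx0 hrad h₀ ↦ ?_⟩
  have htilt := (abs_le.1 (hL₁ x hx).1).2
  have hcx : T ≤ c i * x 0 - L₁ := by linarith
  -- the helix and its endpoint `q S`, `S = τ₁ - x⁰`
  set S : ℝ := τ₁ - x 0 with hS_def
  set Om : ℝ := Kerr.drsrAngularVelocity (M i) (a i) (Kerr.radius (a i) x) with hOm
  obtain ⟨q, hq⟩ : ∃ q : ℝ → E4, ∀ s : ℝ, q s = x + s • E4.basisVector 0 +
      (x 1 * (Real.cos (Om * s) - 1) - x 2 * Real.sin (Om * s)) • E4.basisVector 1 +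
      (x 1 * Real.sin (Om * s) + x 2 * (Real.cos (Om * s) - 1)) • E4.basisVector 2 := ⟨_, fun _ ↦ rfl⟩
  have hqS := helix_invariants hq (M i) (a i) S
  have hqSx : q S ∈ (Kerr.exterior (M i) (a i) : Set E4) :=
    Kerr.mem_exterior.2 (by rw [hqS.2.1]; exact Kerr.mem_exterior.1 hx)
  have h₁ : ((d.motion i).1 : E4 ≃L[ℝ] E4) (Θ i (q S)) + (d.motion i).2 ∈ (d.background i).domain := by
    show poincareInv (d.motion i).1 (d.motion i).2 _ ∈ ((d.adapted i).domain : Set E4)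
    rw [poincareInv_apply_add]; exact hΘm (hsubreg hqSx)
  -- the endpoint is a point of the recut certified slab
  have hend : d.toOver.chart i ⟨((d.motion i).1 : E4 ≃L[ℝ] E4) (Θ i (q S)) + (d.motion i).2, h₁⟩ ∈
      recutCertifiedSlab d M a Θ R' τ₁ := by
    have hPz : poincareInv (d.motion i).1 (d.motion i).2 (((d.motion i).1 : E4 ≃L[ℝ] E4) (q S) + (d.motion i).2) = q S :=
      poincareInv_apply_add _ _ _
    have hz : ((d.motion i).1 : E4 ≃L[ℝ] E4) (q S) + (d.motion i).2 ∈ ((recutBackground d M a i).domain : Set E4) := by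
      show poincareInv (d.motion i).1 (d.motion i).2 _ ∈ (Kerr.exterior (M i) (a i) : Set E4); rw [hPz]; exact hqSx
    refine Or.inr (mem_iUnion.2 ⟨i, mem_image_of_mem _ ⟨_, ⟨⟨_, hz⟩, ⟨?_, ?_⟩, rfl⟩, ?_⟩⟩)
    · show (poincareInv (d.motion i).1 (d.motion i).2 (((d.motion i).1 : E4 ≃L[ℝ] E4) (q S) + (d.motion i).2)) 0 = τ₁
      rw [hPz, (helix_apply hq S).1, hS_def]; ring
    · show Kerr.radius (a i) (poincareInv (d.motion i).1 (d.motion i).2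
        (((d.motion i).1 : E4 ≃L[ℝ] E4) (q S) + (d.motion i).2)) ≤ R' i τ₁
      rw [hPz, hqS.2.1]; exact hrad
    · show ((d.motion i).1 : E4 ≃L[ℝ] E4) (Θ i (poincareInv (d.motion i).1 (d.motion i).2
        (((d.motion i).1 : E4 ≃L[ℝ] E4) (q S) + (d.motion i).2))) + (d.motion i).2 = _
      rw [hPz]
  refine LorentzianMetric.causalFuture_mono (singleton_subset_iff.2 hend) ?_
  rcases (sub_nonneg.2 hx0).eq_or_lt with hS0 | hS'
  · -- `S = 0`: the point itself is on the slab
    have hq0 : q S = x := by rw [hq, show S = 0 by rw [hS_def]; linarith]; simp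
    have hpt : d.toOver.chart i ⟨((d.motion i).1 : E4 ≃L[ℝ] E4) (Θ i (q S)) + (d.motion i).2, h₁⟩ =
        d.toOver.chart i ⟨((d.motion i).1 : E4 ≃L[ℝ] E4) (Θ i x) + (d.motion i).2, h₀⟩ :=
      congrArg (d.toOver.chart i) (Subtype.ext (by simp only [hq0]))
    rw [hpt]; exact LorentzianMetric.subset_causalPast _ _ _ (mem_singleton _)
  · exact LorentzianMetric.mem_causalPast_of_mem_causalFuture
      (LorentzianMetric.chronologicalFuture_subset_causalFuture _ _ _
        (helixLine_mem_chronologicalFuture 𝓢 (d.adapted i) (d.motion i).1 (d.motion i).2 (hW i) (hF5 i)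
          (d.toOver.chart i) (d.toOver.isLateChart i).contMDiff (hii i) (hRm i) hε hL₁0
          (fun u hu ↦ (hL₁ u hu).1) (fun u hu ↦ (hL₁ u hu).2.1) hderiv hmKV hεm
          (fun τ hτ ↦ hT₁ τ ((le_max_left _ _).trans ((le_max_left _ _).trans hτ)))
          (hT₂ T ((le_max_right _ _).trans (le_max_left _ _))) hx hδx hxR hcx
          (by linarith [le_max_right (max T₁ T₂) (d.toOver.τ₀ + 1)]) hq hS' h₀ h₁))

end Summit.FinalStateConjecture.FinalStateConjecture.Theorems.SymplecticDualOfTheBomb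

end
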